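import Summits.MatrixMultiplication.OmegaCensus.BoxUsefulClasses
import Summits.MatrixMultiplication.OmegaCensus.BoxUsefulIndexSix
import Summits.MatrixMultiplication.OmegaCensus.DihC3SqTPP
import Summits.MatrixMultiplication.OmegaCensus.DihC3SqGroups

/-!
# ω-census, family (b3): conjecture C9 (c), the class `𝒞₂` in the kernel — `Coord₂` groups are box-useful; the converse of C9 (b)

HONEST FRAMING (pub-omega census; verbatim): lottery ticket; floor = certified bounds/negative ranges.  Census BOOKKEEPING for
the typed conjecture C9 (`BoxRatioSectionLaw.lean`): `BoxUseful.of_coord2`, the converse direction for the fourth class `𝒞₂`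
(`DihC3Sq.Coord2 c₁ c₂ κ₁ κ₂ ε`: `G = C₃² ⋊_ε C`, `C` abelian acting through `±1`), and the assembled converse of C9 (b)
(`BoxUseful.of_classes`: each of the four classes of the law is box-useful), plus the literal form for `𝒞₂`
(`BoxUseful.of_split`: `G = C₃² ⋊_ε C`, `C` abelian through `±1`, via `DihC3Sq.exists_coord2_of_split`).  Nothing here is progress on `ω`.

The box form of THE LAW of the class `𝒞₂` (`DihC3Sq.Coord2.nine_mul_card_indep_le`, file `DihC3SqTPP`: `9|I| ≤ 16|G|` for
every independent cell set `I ⊆ G × Y × W` with `#Y, #W ≤ 3`, i.e. `α(G;|G|,3,3) ≤ (16/9)|G|`) gives `5|I| < 9|G|`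
(`45|I| ≤ 80|G| < 81|G|`); the cell word of `BoxUseful` is `E2` (definitionally).
-/

namespace Summit.MatrixMultiplication.OmegaCensus

open Finset ProductBoxBound

variable {G : Type*} [Group G]

/-- **C9 (c), class `𝒞₂`, in the kernel.** A finite group carrying the `𝒞₂` coordinate package `DihC3Sq.Coord2` is box-useful
(`9|I| ≤ 16|G|`, hence `5|I| < 9|G|`). [folklore] -/
theorem BoxUseful.of_coord2 [Fintype G] [DecidableEq G] {c₁ c₂ : G} {κ₁ κ₂ ε : G → ZMod 3}
    (hc : DihC3Sq.Coord2 c₁ c₂ κ₁ κ₂ ε) : BoxUseful G := by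
  intro Y W hY hW I hI hind
  have h9 := hc.nine_mul_card_indep_le hY.le hW.le hI fun P hP P' hP' hne =>
    (hind P hP P' hP' hne : cellWord P P' ≠ 1)
  have hpos : 0 < Fintype.card G := Fintype.card_pos
  omega

/-- **The converse of C9 (b), assembled.** Each of the four classes of the box-ratio section law — abelian (`[G:Z(G)] = 1`),
centre of index `4`, centre of index `6`, the `𝒞₂` package `DihC3Sq.Coord2` — is box-useful (`BoxUseful.of_index_center_one`,
`of_index_center_four`, `of_index_center_six`, `of_coord2`). [folklore] -/
theorem BoxUseful.of_classes [Fintype G] [DecidableEq G]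
    (hcl : (Subgroup.center G).index = 1 ∨ (Subgroup.center G).index = 4 ∨ (Subgroup.center G).index = 6 ∨
      ∃ (c₁ c₂ : G) (κ₁ κ₂ ε : G → ZMod 3), DihC3Sq.Coord2 c₁ c₂ κ₁ κ₂ ε) : BoxUseful G := by
  rcases hcl with h1 | h4 | h6 | ⟨c₁, c₂, κ₁, κ₂, ε, hc⟩
  · exact BoxUseful.of_index_center_one h1
  · exact BoxUseful.of_index_center_four h4
  · exact BoxUseful.of_index_center_six h6
  · exact BoxUseful.of_coord2 hc

/-- **C9 (c), class `𝒞₂`, literal form.** `G = K·C` with `K = ⟨c₁, c₂⟩ ≅ C₃²` meeting the abelian subgroup `C` trivially and every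
element of `C` centralising or inverting `K` (`G ≅ C₃² ⋊_ε C`) ⇒ `G` is box-useful. [folklore] -/
theorem BoxUseful.of_split [Fintype G] [DecidableEq G] {c₁ c₂ : G} {C : Subgroup G} (h1 : c₁ * c₁ * c₁ = 1)
    (h2 : c₂ * c₂ * c₂ = 1) (h12 : c₁ * c₂ = c₂ * c₁) (hC : ∀ γ ∈ C, ∀ δ ∈ C, γ * δ = δ * γ)
    (hKC : ∀ a b : ℕ, c₁ ^ a * c₂ ^ b ∈ C → (a : ZMod 3) = 0 ∧ (b : ZMod 3) = 0)
    (hgen : ∀ g : G, ∃ (a b : ℕ) (γ : G), γ ∈ C ∧ g = c₁ ^ a * c₂ ^ b * γ)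
    (hact : ∀ γ ∈ C, (γ * c₁ * γ⁻¹ = c₁ ∧ γ * c₂ * γ⁻¹ = c₂) ∨ (γ * c₁ * γ⁻¹ = c₁⁻¹ ∧ γ * c₂ * γ⁻¹ = c₂⁻¹)) :
    BoxUseful G := by
  obtain ⟨κ₁, κ₂, ε, hc⟩ := DihC3Sq.exists_coord2_of_split h1 h2 h12 hC hKC hgen hact
  exact BoxUseful.of_coord2 hc

end Summit.MatrixMultiplication.OmegaCensus
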